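import Summits.QuantumFields.BalabanUV.InfraRed.StrongCouplingTwelveSeventhsCertificate
import Summits.QuantumFields.BalabanUV.InfraRed.StrongCouplingFluxCovariance
import HarnessLib

/-!
# Strong-coupling front, rung F4(12/7) (part 3/4): the flux inequality and the one-link covariance bound
`|Cov_{ν_B}(φ, 2 Re tr(· Δ))| ≤ L ‖Δ‖_F` on the ball `‖B‖_op ≤ 3/7` — PROVED —
observatory of the non-perturbative crossover; no mass-gap claim

IR-3 v2 TWO-FRONT CROSSOVER LEDGER, front SC (`β₀`), SU(2), `d = 4`, Wilson normalisation `β_W = 4/g²`.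
ABSOLUTE RULE of this package: No internally-minted statement may enter as a cited fact. Every hypothesis is either
kernel-proved in this package or a verbatim quotation of a PUBLISHED theorem with page reference. The manuscript(s)
under audit are NOT citable for their own disputed steps — they are the thing under adjudication; programme-internal
(2001/route/tribunal) claims are never citable.

WHAT THIS FILE PROVES.  `flux_bound127` and `quarterCovariance127`: the tree's `flux_bound85` ∕ `quarterCovariance85`
(`StrongCouplingEightFifthsCovariance`; originally `StrongCouplingFluxCovariance`, J-SC16k: rotate the tilt axis,
centre, normal component of the divergence-managed test field `λ`, Lipschitz–flux inequality, `fluxRHS_eq`, ball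
certificate) VERBATIM, with the single input `ball_certificate85` (`κ = 4|qp B| ≤ 8/5`) replaced by part 2's
`ball_certificate127` (`κ ≤ 12/7`) and the rational brackets by part 1's cancellation brackets (`cancel_brackets85`
below `8/5`, `cancel_piece127` on the piece); hence the one-link covariance bound for every `B` with `‖B‖_op ≤ 3/7`
(`= 3β_W/2` at `β_W = 2/7`), every direction `Δ` and every bounded measurable `L`-Lipschitz `φ`.  Part 4
(`StrongCouplingQuarterModulusTwoSevenths`) integrates it along segments to `OneLinkKRModulusSU2 β_W (1/4)` for
`0 ≤ β_W ≤ 2/7` — exactly the range on which the axial-gauge door `14 · β_W · (1/4) < 1` of the transfer-operator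
gap is open (`β_W < 2/7`).

NOT CLAIMED: a one-link (single-site) statement only; no number of the ledger moves in this file; no mass-gap claim.
-/

noncomputable section

open MeasureTheory Filter Finset Real
open scoped NNReal Quaternion Matrix ComplexConjugate BigOperators Matrix.Norms.Frobenius ContDiff Topology
  RealInnerProductSpace

open Matrix Complex
open Literature.MathematicalPhysics.QuantumLattice (su2Quat quatMatrix quatMatrix_mul quatMatrix_su2Quat norm_su2Quat)
open Literature.MathematicalPhysics.QuantumFieldTheory
open Literature.MathematicalPhysics.QuantumFieldTheory.SUNBakryEmery
open Literature.MathematicalPhysics.QuantumFieldTheory.Balaban1983to89.StrongCouplingVarianceWindow (qI qJ qK)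
open Literature.MathematicalPhysics.QuantumLattice (fundamentalRep fundamentalLatticeRep)
open Literature.MathematicalPhysics.QuantumFieldTheory.Balaban1983to89
open Literature.MathematicalPhysics.QuantumFieldTheory.Balaban1983to89.StrongCouplingVarianceWindow
open Literature.MathematicalPhysics.QuantumFieldTheory.Balaban1983to89.StrongCouplingKernelWindow
open Literature.MathematicalPhysics.QuantumFieldTheory.Balaban1983to89.StrongCouplingDobrushinWindow
open Literature.MathematicalPhysics.QuantumFieldTheory.Balaban1983to89.StrongCouplingTorusWindow
open Literature.MathematicalPhysics.QuantumFieldTheory.Balaban1983to89.StrongCouplingOpenWindow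
open Literature.Probability.LatticeModels
open Summit.QuantumFields.BalabanUV.InfraRed.StrongCouplingSixFifthsVariance
open Summit.QuantumFields.BalabanUV.InfraRed.StrongCouplingReflection
open Summit.QuantumFields.BalabanUV.InfraRed.StrongCouplingTransverseMoment

open Summit.QuantumFields.BalabanUV.InfraRed.StrongCouplingSphereCalculus (radialDiv quatOfMat quatOfMat_coe)
open Summit.QuantumFields.BalabanUV.InfraRed.StrongCouplingLipschitzFlux (abs_integral_lipschitz_mul_inner_le)
open Summit.QuantumFields.BalabanUV.InfraRed.StrongCouplingFluxField
open Summit.QuantumFields.BalabanUV.InfraRed.StrongCouplingFluxMoments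
open Summit.QuantumFields.BalabanUV.InfraRed.StrongCouplingFluxLambda
open Summit.QuantumFields.BalabanUV.InfraRed.StrongCouplingCertArith (le_sqrt_mul_sqrt_of_forall add_mul_le_of_cert)
open Summit.QuantumFields.BalabanUV.InfraRed.StrongCouplingBallCertificate
open Summit.QuantumFields.BalabanUV.InfraRed.StrongCouplingQuarterCovariance

namespace Summit.QuantumFields.BalabanUV.InfraRed.StrongCouplingTwelveSeventhsCovariance

open Summit.QuantumFields.BalabanUV.InfraRed.StrongCouplingFluxCovariance (inner_coe_left re_mul_coe)
open Summit.QuantumFields.BalabanUV.InfraRed.StrongCouplingEightFifthsBrackets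
open Summit.QuantumFields.BalabanUV.InfraRed.StrongCouplingTwelveSeventhsBrackets
open Summit.QuantumFields.BalabanUV.InfraRed.StrongCouplingTwelveSeventhsCertificate (ball_certificate127)

/-! ## 1. The flux inequality `|p|·Y + X ≤ (Z/4)·n` on `0 < κ ≤ 12/7` -/

/-- **The flux inequality on the range `0 < κ ≤ 12/7`.**  For a purely imaginary `d'` and reals `p`, `n ≥ 0` with
`‖d'‖² + p² = n²`, the flux functional of the test field obeys `|p|·Y + X ≤ (Z/4)·n` — the tree's `flux_bound85`
with `ball_certificate127` in place of `ball_certificate85`. [folklore] -/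
theorem flux_bound127 {κ p n Z Zp zB m2 J41 J52 J61 J72 J63 J74 Y H X Q : ℝ} {d' : ℍ} (hκ0 : 0 < κ) (hκ1 : κ ≤ 12 / 7)
    (hd' : d'.re = 0) (hn : ‖d'‖ ^ 2 + p ^ 2 = n ^ 2) (hn0 : 0 ≤ n)
    (hZ : Z = ∫ g, Real.exp (κ * (su2Quat g).re) ∂haarProbability (Matrix.specialUnitaryGroup (Fin 2) ℂ))
    (hZp : Zp = ∫ g, (su2Quat g).re * Real.exp (κ * (su2Quat g).re) ∂haarProbability (Matrix.specialUnitaryGroup (Fin 2) ℂ))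
    (hzB : zB = ∫ r in (0:ℝ)..1, r ^ 3 * ∫ g, Real.exp (κ * r * (su2Quat g).re) ∂haarProbability (Matrix.specialUnitaryGroup (Fin 2) ℂ))
    (hm2 : m2 = ∫ r in (0:ℝ)..1, r ^ 5 * ∫ g, Real.exp (κ * r * (su2Quat g).re) ∂haarProbability (Matrix.specialUnitaryGroup (Fin 2) ℂ))
    (hJ41 : J41 = ∫ r in (0:ℝ)..1, r ^ 4 * ∫ g, (su2Quat g).re * Real.exp (κ * r * (su2Quat g).re)
      ∂haarProbability (Matrix.specialUnitaryGroup (Fin 2) ℂ))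
    (hJ52 : J52 = ∫ r in (0:ℝ)..1, r ^ 5 * ∫ g, (su2Quat g).re ^ 2 * Real.exp (κ * r * (su2Quat g).re)
      ∂haarProbability (Matrix.specialUnitaryGroup (Fin 2) ℂ))
    (hJ61 : J61 = ∫ r in (0:ℝ)..1, r ^ 6 * ∫ g, (su2Quat g).re * Real.exp (κ * r * (su2Quat g).re)
      ∂haarProbability (Matrix.specialUnitaryGroup (Fin 2) ℂ))
    (hJ72 : J72 = ∫ r in (0:ℝ)..1, r ^ 7 * ∫ g, (su2Quat g).re ^ 2 * Real.exp (κ * r * (su2Quat g).re)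
      ∂haarProbability (Matrix.specialUnitaryGroup (Fin 2) ℂ))
    (hJ63 : J63 = ∫ r in (0:ℝ)..1, r ^ 6 * ∫ g, (su2Quat g).re ^ 3 * Real.exp (κ * r * (su2Quat g).re)
      ∂haarProbability (Matrix.specialUnitaryGroup (Fin 2) ℂ))
    (hJ74 : J74 = ∫ r in (0:ℝ)..1, r ^ 7 * ∫ g, (su2Quat g).re ^ 4 * Real.exp (κ * r * (su2Quat g).re)
      ∂haarProbability (Matrix.specialUnitaryGroup (Fin 2) ℂ))
    (hY : Y = ∫ r in (0:ℝ)..1, r ^ 4 * ∫ g, Real.exp (κ * r * (su2Quat g).re) *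
      |(κ * (1 - κ ^ 2 / 20) - 4 * (Zp / Z)) + (κ ^ 2 / 4 - κ * (Zp / Z)) * (r * (su2Quat g).re) +
        (κ ^ 3 / 20) * (r * (su2Quat g).re) ^ 2| ∂haarProbability (Matrix.specialUnitaryGroup (Fin 2) ℂ))
    (hH : H = ∫ r in (0:ℝ)..1, r ^ 3 * ∫ g, Real.exp (κ * r * (su2Quat g).re) *
      ((κ * (1 - κ ^ 2 / 20) - 4 * (Zp / Z)) + (κ ^ 2 / 4 - κ * (Zp / Z)) * (r * (su2Quat g).re) +
        (κ ^ 3 / 20) * (r * (su2Quat g).re) ^ 2) ^ 2 ∂haarProbability (Matrix.specialUnitaryGroup (Fin 2) ℂ))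
    (hX : X = ∫ r in (0:ℝ)..1, r ^ 3 * ∫ g, Real.exp (κ * r * (su2Quat g).re) *
      ‖(d' + ((p * (1 - κ ^ 2 / 20) : ℝ) : ℍ)) + ((p * (κ ^ 2 / 20)) * (r * (su2Quat g).re) + -(p * (Zp / Z))) • (r • su2Quat g)‖
      ∂haarProbability (Matrix.specialUnitaryGroup (Fin 2) ℂ))
    (hQ : Q = ∫ r in (0:ℝ)..1, r ^ 3 * ∫ g, Real.exp (κ * r * (su2Quat g).re) *
      ‖(d' + ((p * (1 - κ ^ 2 / 20) : ℝ) : ℍ)) + ((p * (κ ^ 2 / 20)) * (r * (su2Quat g).re) + -(p * (Zp / Z))) • (r • su2Quat g)‖ ^ 2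
      ∂haarProbability (Matrix.specialUnitaryGroup (Fin 2) ℂ)) :
    |p| * Y + X ≤ Z / 4 * n := by
  -- the brackets `1 ≤ Z`, `1/4 ≤ z_B < Z/4`: below `8/5` from `cancel_brackets85`, on the piece from `cancel_piece127`
  obtain ⟨hZ1, hzBl, hzBZ⟩ : 1 ≤ Z ∧ 1 / 4 ≤ zB ∧ zB < Z / 4 := by
    rcases le_or_gt κ (8 / 5) with h85 | h85
    · obtain ⟨hZl, hZu⟩ := Z_bracket85 hκ0.le h85
      obtain ⟨hZpl, hZpu⟩ := Zp_bracket85 hκ0.le h85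
      obtain ⟨hBl, hBu⟩ := zB_bracket85 hκ0.le h85
      rw [← hZ] at hZl hZu
      rw [← hZp] at hZpl hZpu
      rw [← hzB] at hBl hBu
      have hb := cancel_brackets85 hκ0.le h85 hZl hZu hZpl hZpu hBl hBu
      have hgap : κ ^ 2 / 24 + κ ^ 4 / 400 ≤ Z - 4 * zB := hb.2.2.2.2.2.2
      have hκ2 : 0 < κ ^ 2 := by positivity
      have hκ4 : 0 ≤ κ ^ 4 := by positivity
      exact ⟨hb.1, hb.2.1, by linarith⟩
    · obtain ⟨hZl, hZu⟩ := Z_bracket127 hκ0.le hκ1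
      obtain ⟨hZpl, hZpu⟩ := Zp_bracket127 hκ0.le hκ1
      obtain ⟨hBl, hBu⟩ := zB_bracket127 hκ0.le hκ1
      rw [← hZ] at hZl hZu
      rw [← hZp] at hZpl hZpu
      rw [← hzB] at hBl hBu
      have hb := cancel_piece127 h85.le hκ1 hZl hZu hZpl hZpu hBl hBu
      have hgap : 123 / 1000 ≤ Z - 4 * zB := hb.2.2.2.2.2.2
      exact ⟨hb.1, hb.2.1, by linarith⟩
  have hzBpos : 0 < zB := by linarith
  have hcert := ball_certificate127 hκ0 hκ1 hZ hZp hzB hm2 hJ41 hJ52 hJ61 hJ72 hJ63 hJ74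
  -- nonnegativity of the ball integrals
  have hY0 : 0 ≤ Y := by
    rw [hY]; exact ball_integral_nonneg (fun r g => mul_nonneg (Real.exp_pos _).le (abs_nonneg _)) 4
  have hm20 : 0 ≤ m2 := by rw [hm2]; exact ball_integral_nonneg (fun r g => (Real.exp_pos _).le) 5
  have hH0 : 0 ≤ H := by
    rw [hH]; exact ball_integral_nonneg (fun r g => mul_nonneg (Real.exp_pos _).le (sq_nonneg _)) 3
  have hX0 : 0 ≤ X := by
    rw [hX]; exact ball_integral_nonneg (fun r g => mul_nonneg (Real.exp_pos _).le (norm_nonneg _)) 3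
  have hQ0 : 0 ≤ Q := by
    rw [hQ]; exact ball_integral_nonneg (fun r g => mul_nonneg (Real.exp_pos _).le (sq_nonneg _)) 3
  -- `Y ≤ √m₂ √H` and the expansion of `H`
  have hYe : Y ≤ Real.sqrt m2 * Real.sqrt H := by
    refine le_sqrt_mul_sqrt_of_forall hm20 hH0 fun l hl => ?_
    have h := Y_le κ (κ * (1 - κ ^ 2 / 20) - 4 * (Zp / Z)) (κ ^ 2 / 4 - κ * (Zp / Z)) (κ ^ 3 / 20) hl
    rw [← hY, ← hm2, ← hH] at h
    exact h
  have hHe : H = (κ * (1 - κ ^ 2 / 20) - 4 * (Zp / Z)) ^ 2 * zB +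
      2 * (κ * (1 - κ ^ 2 / 20) - 4 * (Zp / Z)) * (κ ^ 2 / 4 - κ * (Zp / Z)) * J41 +
      ((κ ^ 2 / 4 - κ * (Zp / Z)) ^ 2 + 2 * (κ * (1 - κ ^ 2 / 20) - 4 * (Zp / Z)) * (κ ^ 3 / 20)) * J52 +
      2 * (κ ^ 2 / 4 - κ * (Zp / Z)) * (κ ^ 3 / 20) * J63 + (κ ^ 3 / 20) ^ 2 * J74 := by
    have h := H_expand κ (κ * (1 - κ ^ 2 / 20) - 4 * (Zp / Z)) (κ ^ 2 / 4 - κ * (Zp / Z)) (κ ^ 3 / 20)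
    rw [← hH, ← hzB, ← hJ41, ← hJ52, ← hJ63, ← hJ74] at h
    exact h
  -- `X² ≤ z_B Q` and the expansion of `Q`
  have hXe : X ≤ Real.sqrt zB * Real.sqrt Q := by
    refine le_sqrt_mul_sqrt_of_forall hzBpos.le hQ0 fun l hl => ?_
    have h := X_le κ (p * (κ ^ 2 / 20)) (-(p * (Zp / Z))) (d' + ((p * (1 - κ ^ 2 / 20) : ℝ) : ℍ)) hl
    rw [← hX, ← hzB, ← hQ] at h
    exact h
  have hQe : Q = (‖d'‖ ^ 2 + (p * (1 - κ ^ 2 / 20)) ^ 2) * zB + 2 * (p * (1 - κ ^ 2 / 20)) * (-(p * (Zp / Z))) * J41 +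
      2 * (p * (1 - κ ^ 2 / 20)) * (p * (κ ^ 2 / 20)) * J52 + (-(p * (Zp / Z))) ^ 2 * m2 +
      2 * (p * (κ ^ 2 / 20)) * (-(p * (Zp / Z))) * J61 + (p * (κ ^ 2 / 20)) ^ 2 * J72 := by
    have h := Q_expand κ (p * (κ ^ 2 / 20)) (-(p * (Zp / Z))) (p * (1 - κ ^ 2 / 20)) hd'
    rw [← hQ, ← hzB, ← hJ41, ← hJ52, ← hm2, ← hJ61, ← hJ72] at h
    exact h
  have hX2 : X ^ 2 ≤ zB * ((n ^ 2 - |p| ^ 2) * zB + |p| ^ 2 * ((1 - κ ^ 2 / 20) ^ 2 * zB +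
      2 * (1 - κ ^ 2 / 20) * (κ ^ 2 / 20) * J52 - 2 * (1 - κ ^ 2 / 20) * (Zp / Z) * J41 + (κ ^ 2 / 20) ^ 2 * J72 -
      2 * (κ ^ 2 / 20) * (Zp / Z) * J61 + (Zp / Z) ^ 2 * m2)) := by
    have h1 : X ^ 2 ≤ (Real.sqrt zB * Real.sqrt Q) ^ 2 := pow_le_pow_left₀ hX0 hXe 2
    rw [mul_pow, Real.sq_sqrt hzBpos.le, Real.sq_sqrt hQ0, hQe] at h1
    have hd2 : ‖d'‖ ^ 2 = n ^ 2 - p ^ 2 := by linarith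
    rw [hd2] at h1
    rw [sq_abs]
    refine h1.trans (le_of_eq ?_)
    ring
  -- `0 ≤ q_V` (it is the `Q` of the axial field `d' = 0`, `p = 1`)
  have hq0 : 0 ≤ (1 - κ ^ 2 / 20) ^ 2 * zB + 2 * (1 - κ ^ 2 / 20) * (κ ^ 2 / 20) * J52 -
      2 * (1 - κ ^ 2 / 20) * (Zp / Z) * J41 + (κ ^ 2 / 20) ^ 2 * J72 - 2 * (κ ^ 2 / 20) * (Zp / Z) * J61 +
      (Zp / Z) ^ 2 * m2 := by
    have h := Q_expand κ (κ ^ 2 / 20) (-(Zp / Z)) (1 - κ ^ 2 / 20) (d' := 0) Quaternion.re_zero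
    rw [← hzB, ← hJ41, ← hJ52, ← hm2, ← hJ61, ← hJ72, norm_zero] at h
    have h0 := ball_integral_nonneg (fun r (g : Matrix.specialUnitaryGroup (Fin 2) ℂ) => mul_nonneg (Real.exp_pos
      (κ * r * (su2Quat g).re)).le (sq_nonneg ‖((0 : ℍ) + (((1 - κ ^ 2 / 20) : ℝ) : ℍ)) +
        ((κ ^ 2 / 20) * (r * (su2Quat g).re) + -(Zp / Z)) • (r • su2Quat g)‖)) 3
    rw [h] at h0
    refine h0.trans (le_of_eq ?_)
    ring
  -- the certificate in `add_mul_le_of_cert` form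
  have hcert' : (Real.sqrt m2 * Real.sqrt H) ^ 2 * zB ≤ ((Z / 4) ^ 2 - zB ^ 2) * (zB - ((1 - κ ^ 2 / 20) ^ 2 * zB +
      2 * (1 - κ ^ 2 / 20) * (κ ^ 2 / 20) * J52 - 2 * (1 - κ ^ 2 / 20) * (Zp / Z) * J41 + (κ ^ 2 / 20) ^ 2 * J72 -
      2 * (κ ^ 2 / 20) * (Zp / Z) * J61 + (Zp / Z) ^ 2 * m2)) := by
    rw [mul_pow, Real.sq_sqrt hm20, Real.sq_sqrt hH0, hHe]
    linarith
  have hpn : |p| ≤ n := by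
    have h2 : p ^ 2 ≤ n ^ 2 := by linarith [sq_nonneg ‖d'‖]
    rw [← Real.sqrt_sq_eq_abs, ← Real.sqrt_sq hn0]
    exact Real.sqrt_le_sqrt h2
  rw [add_comm]
  exact add_mul_le_of_cert hzBpos hzBZ hq0 hcert' hX0 hX2 hY0 hYe (abs_nonneg p) hpn

/-! ## 2. The one-link covariance bound on the ball `‖B‖_op ≤ 3/7` -/

/-- **One-link covariance bound on the ball `‖B‖_op ≤ 3/7`.**  For every `B` with `‖B‖_op ≤ 3/7`, every `Δ`, and
every bounded measurable `φ` that is `L`-Lipschitz for the Frobenius distance on `SU(2)`: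
`|Cov_{ν_B}(φ, 2 Re tr(· Δ))| ≤ L ‖Δ‖_F`, `ν_B = σ.tilted (2 Re tr(· B))` — the tree's `quarterCovariance` proof
(J-SC16k) verbatim with `κ = 4|qp B| ≤ 12/7` and `flux_bound127`. [folklore] -/
theorem quarterCovariance127 (B Δ : Matrix (Fin 2) (Fin 2) ℂ) (hB : matrixOpNorm B ≤ 3 / 7)
    (φ : Matrix.specialUnitaryGroup (Fin 2) ℂ → ℝ) (L : ℝ) (hφm : Measurable φ) (hφb : ∃ C, ∀ s, |φ s| ≤ C)
    (hL : 0 ≤ L) (hφL : ∀ a b, |φ a - φ b| ≤ L * suFrobDist a b) :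
    |∫ s, φ s * pot Δ s ∂((haarProbability (Matrix.specialUnitaryGroup (Fin 2) ℂ)).tilted (pot B)) -
        (∫ s, φ s ∂((haarProbability (Matrix.specialUnitaryGroup (Fin 2) ℂ)).tilted (pot B))) *
          ∫ s, pot Δ s ∂((haarProbability (Matrix.specialUnitaryGroup (Fin 2) ℂ)).tilted (pot B))|
      ≤ L * frobNorm Δ := by
  by_cases hm : qp B = 0
  · exact cov_pot_le_of_transverse B Δ (by rw [hm, star_zero, mul_zero, Quaternion.re_zero]) hφm hφb hL hφL
  obtain ⟨C, hC⟩ := hφb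
  obtain ⟨y, hy1, hy⟩ := exists_unit_mul_eq_norm (qp B)
  have hmpos : 0 < ‖qp B‖ := norm_pos_iff.2 hm
  obtain ⟨κ, hκ⟩ : ∃ κ : ℝ, κ = 4 * ‖qp B‖ := ⟨_, rfl⟩
  have hκ0 : 0 < κ := by rw [hκ]; positivity
  obtain ⟨u0, hu0def⟩ : ∃ u : Matrix.specialUnitaryGroup (Fin 2) ℂ, u = unitSU2 y hy1 := ⟨_, rfl⟩
  have hu0 : su2Quat u0 = y := by rw [hu0def]; exact su2Quat_unitSU2 y hy1
  -- `κ ≤ 12/7` from the ball `‖B‖_op ≤ 3/7`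
  have hκ1 : κ ≤ 12 / 7 := by
    have h1 := abs_re_trace_su2_mul_le_opNorm u0 B
    have h2 : pot B u0 = 2 * ((u0 : Matrix (Fin 2) (Fin 2) ℂ) * B).trace.re := rfl
    have h3 : pot B u0 = κ := by rw [pot_eq, hu0, hy, Quaternion.re_coe, hκ]
    have h4 := le_abs_self (((u0 : Matrix (Fin 2) (Fin 2) ℂ) * B).trace.re)
    linarith
  -- the potentials after the right rotation by `u⁰`
  have hpotB : ∀ g, pot B (g * u0) = κ * (su2Quat g).re := fun g => by
    rw [pot_eq, su2Quat_mul, hu0, mul_assoc, hy, re_mul_coe, hκ]; ring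
  obtain ⟨d, hd⟩ : ∃ d : ℍ, d = star (y * qp Δ) := ⟨_, rfl⟩
  have hpotΔ : ∀ g, pot Δ (g * u0) = 4 * ⟪d, su2Quat g⟫ := fun g => by
    rw [pot_eq, su2Quat_mul, hu0, mul_assoc, hd, Quaternion.inner_def, ← star_mul, Quaternion.re_star]
  have hnd : ‖d‖ = ‖qp Δ‖ := by rw [hd, norm_star, norm_mul, hy1, one_mul]
  obtain ⟨p, hp⟩ : ∃ p : ℝ, p = d.re := ⟨_, rfl⟩
  obtain ⟨d', hd'⟩ : ∃ d' : ℍ, d' = d - (p : ℍ) := ⟨_, rfl⟩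
  have hd're : d'.re = 0 := by rw [hd', Quaternion.re_sub, Quaternion.re_coe, hp, sub_self]
  have hdd : d = d' + (p : ℍ) := by rw [hd', sub_add_cancel]
  have hn2 : ‖d'‖ ^ 2 + p ^ 2 = ‖qp Δ‖ ^ 2 := by
    have h := norm_sq_affine d' hd're p 0 1 norm_one
    rw [zero_smul, add_zero, ← hdd, hnd] at h
    linarith
  have hdx : ∀ g, ⟪d, su2Quat g⟫ = ⟪d', su2Quat g⟫ + p * (su2Quat g).re := fun g => by
    rw [hdd, inner_add_left, inner_coe_left]
  -- the two normalising moments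
  obtain ⟨Z, hZ⟩ : ∃ Z : ℝ, Z = ∫ g, Real.exp (κ * (su2Quat g).re)
    ∂haarProbability (Matrix.specialUnitaryGroup (Fin 2) ℂ) := ⟨_, rfl⟩
  obtain ⟨Zp, hZp⟩ : ∃ Zp : ℝ, Zp = ∫ g, (su2Quat g).re * Real.exp (κ * (su2Quat g).re)
    ∂haarProbability (Matrix.specialUnitaryGroup (Fin 2) ℂ) := ⟨_, rfl⟩
  have hexpF := integrable_exp_pot B
  have hZrot : ∫ s, Real.exp (pot B s) ∂haarProbability (Matrix.specialUnitaryGroup (Fin 2) ℂ) = Z := by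
    have h := integral_mul_right_eq_self (μ := haarProbability (Matrix.specialUnitaryGroup (Fin 2) ℂ))
      (fun s : Matrix.specialUnitaryGroup (Fin 2) ℂ => Real.exp (pot B s)) u0
    simp only [hpotB] at h
    rw [hZ, ← h]
  have hZpos : 0 < Z := by rw [← hZrot]; exact integral_exp_pos hexpF
  have hZne : Z ≠ 0 := hZpos.ne'
  -- the tilted law: integrability and centring
  haveI : IsProbabilityMeasure ((haarProbability (Matrix.specialUnitaryGroup (Fin 2) ℂ)).tilted (pot B)) :=
    isProbabilityMeasure_tilted hexpF
  have hpm : Measurable (pot Δ) := (continuous_pot Δ).measurable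
  have hφi : Integrable φ ((haarProbability (Matrix.specialUnitaryGroup (Fin 2) ℂ)).tilted (pot B)) :=
    integrable_of_measurable_of_abs_le hφm hC
  have hφpi : Integrable (fun s => φ s * pot Δ s) ((haarProbability (Matrix.specialUnitaryGroup (Fin 2) ℂ)).tilted (pot B)) :=
    integrable_of_measurable_of_abs_le (hφm.mul hpm) (C := C * (2 * (Real.sqrt 2 * frobNorm Δ))) fun s => by
      rw [abs_mul]; exact mul_le_mul (hC s) (abs_pot_le Δ s) (abs_nonneg _) ((abs_nonneg _).trans (hC s))
  obtain ⟨E3, hE3⟩ : ∃ E : ℝ, E = ∫ s, pot Δ s ∂((haarProbability (Matrix.specialUnitaryGroup (Fin 2) ℂ)).tilted (pot B)) :=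
    ⟨_, rfl⟩
  have hc1 : ∫ s, φ s * pot Δ s ∂((haarProbability (Matrix.specialUnitaryGroup (Fin 2) ℂ)).tilted (pot B)) -
      (∫ s, φ s ∂((haarProbability (Matrix.specialUnitaryGroup (Fin 2) ℂ)).tilted (pot B))) *
        ∫ s, pot Δ s ∂((haarProbability (Matrix.specialUnitaryGroup (Fin 2) ℂ)).tilted (pot B)) =
      ∫ s, φ s * (pot Δ s - E3) ∂((haarProbability (Matrix.specialUnitaryGroup (Fin 2) ℂ)).tilted (pot B)) := by
    have h : ∫ s, φ s * (pot Δ s - E3) ∂((haarProbability (Matrix.specialUnitaryGroup (Fin 2) ℂ)).tilted (pot B)) =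
        ∫ s, φ s * pot Δ s ∂((haarProbability (Matrix.specialUnitaryGroup (Fin 2) ℂ)).tilted (pot B)) -
        ∫ s, E3 * φ s ∂((haarProbability (Matrix.specialUnitaryGroup (Fin 2) ℂ)).tilted (pot B)) := by
      rw [← integral_sub hφpi (hφi.const_mul E3)]
      refine integral_congr_ae (ae_of_all _ fun s => ?_)
      ring
    rw [h, integral_const_mul, ← hE3]
    ring
  -- the mean `E₃ = ν_B(pot Δ) = 4 p Z′/Z`
  have hq1 : Continuous fun g : Matrix.specialUnitaryGroup (Fin 2) ℂ => su2Quat g := by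
    have h : Continuous fun g : Matrix.specialUnitaryGroup (Fin 2) ℂ => quatOfMat (g : Matrix (Fin 2) (Fin 2) ℂ) :=
      (LinearMap.continuous_of_finiteDimensional quatOfMat).comp continuous_subtype_val
    simpa only [quatOfMat_coe] using h
  have hq : Continuous fun g : Matrix.specialUnitaryGroup (Fin 2) ℂ => (su2Quat g).re := Quaternion.continuous_re.comp hq1
  have hE3' : E3 = 4 * p * Zp / Z := by
    rw [hE3, integral_tilted]
    simp_rw [smul_eq_mul, div_mul_eq_mul_div]
    rw [integral_div, hZrot]
    have h := integral_mul_right_eq_self (μ := haarProbability (Matrix.specialUnitaryGroup (Fin 2) ℂ))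
      (fun s : Matrix.specialUnitaryGroup (Fin 2) ℂ => Real.exp (pot B s) * pot Δ s) u0
    simp only [hpotB, hpotΔ, hdx] at h
    rw [← h]
    have i1 : Integrable (fun g : Matrix.specialUnitaryGroup (Fin 2) ℂ => ⟪d', su2Quat g⟫ * Real.exp (κ * (su2Quat g).re))
        (haarProbability (Matrix.specialUnitaryGroup (Fin 2) ℂ)) := integrable_of_continuous_SUN (by fun_prop) _
    have i2 : Integrable (fun g : Matrix.specialUnitaryGroup (Fin 2) ℂ => (su2Quat g).re * Real.exp (κ * (su2Quat g).re))
        (haarProbability (Matrix.specialUnitaryGroup (Fin 2) ℂ)) := integrable_of_continuous_SUN (by fun_prop) _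
    have i12 : Integrable (fun g : Matrix.specialUnitaryGroup (Fin 2) ℂ => 4 * (⟪d', su2Quat g⟫ * Real.exp (κ * (su2Quat g).re)) +
        4 * p * ((su2Quat g).re * Real.exp (κ * (su2Quat g).re))) (haarProbability (Matrix.specialUnitaryGroup (Fin 2) ℂ)) :=
      (i1.const_mul _).add (i2.const_mul _)
    have e : ∫ g, Real.exp (κ * (su2Quat g).re) * (4 * (⟪d', su2Quat g⟫ + p * (su2Quat g).re))
        ∂haarProbability (Matrix.specialUnitaryGroup (Fin 2) ℂ) =
        4 * (∫ g, ⟪d', su2Quat g⟫ * Real.exp (κ * (su2Quat g).re) ∂haarProbability (Matrix.specialUnitaryGroup (Fin 2) ℂ)) +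
        4 * p * ∫ g, (su2Quat g).re * Real.exp (κ * (su2Quat g).re) ∂haarProbability (Matrix.specialUnitaryGroup (Fin 2) ℂ) := by
      rw [← integral_const_mul, ← integral_const_mul, ← integral_add (i1.const_mul _) (i2.const_mul _)]
      refine integral_congr_ae (ae_of_all _ fun g => ?_)
      ring
    have h0' := integral_inner_mul_eq_zero hd're (fun t => Real.exp (κ * t))
    beta_reduce at h0'
    rw [e, h0', ← hZp]
    ring
  -- Lipschitz transport of `φ` along the rotation
  have hψL : ∀ a b : Matrix.specialUnitaryGroup (Fin 2) ℂ, |φ (a * u0) - φ (b * u0)| ≤ L * suFrobDist a b := fun a b => by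
    have h := hφL (a * u0) (b * u0)
    rwa [suFrobDist_eq_sqrt_two_mul, su2Quat_mul, su2Quat_mul, hu0, ← sub_mul, norm_mul, hy1, mul_one,
      ← suFrobDist_eq_sqrt_two_mul] at h
  -- the centred observable is the normal component of the test field `λ`, and `σ(⟪λ, x⟫) = 0`
  have h0 : ∫ g, ⟪Real.exp (κ * (su2Quat g).re) • ((d' + ((p * (1 - κ ^ 2 / 20) : ℝ) : ℍ)) +
      ((p * (κ ^ 2 / 20)) * (su2Quat g).re + -(p * (Zp / Z))) • su2Quat g), su2Quat g⟫
      ∂haarProbability (Matrix.specialUnitaryGroup (Fin 2) ℂ) = 0 := by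
    rw [integral_inner_fluxField κ hd're (p * (1 - κ ^ 2 / 20)) (p * (κ ^ 2 / 20)) (-(p * (Zp / Z))), ← hZ, ← hZp]
    field_simp
    ring
  have hnum : ∫ s, Real.exp (pot B s) * (φ s * (pot Δ s - E3)) ∂haarProbability (Matrix.specialUnitaryGroup (Fin 2) ℂ) =
      4 * ∫ g, φ (g * u0) * ⟪Real.exp (κ * (su2Quat g).re) • ((d' + ((p * (1 - κ ^ 2 / 20) : ℝ) : ℍ)) +
        ((p * (κ ^ 2 / 20)) * (su2Quat g).re + -(p * (Zp / Z))) • su2Quat g), su2Quat g⟫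
        ∂haarProbability (Matrix.specialUnitaryGroup (Fin 2) ℂ) := by
    have h := integral_mul_right_eq_self (μ := haarProbability (Matrix.specialUnitaryGroup (Fin 2) ℂ))
      (fun s : Matrix.specialUnitaryGroup (Fin 2) ℂ => Real.exp (pot B s) * (φ s * (pot Δ s - E3))) u0
    simp only [hpotB, hpotΔ, hdx] at h
    rw [← h, ← integral_const_mul]
    refine integral_congr_ae (ae_of_all _ fun g => ?_)
    beta_reduce
    rw [inner_fluxField, norm_su2Quat, one_pow, mul_one, inner_add_left, inner_coe_left, hE3']
    field_simp
    ring
  -- the Lipschitz–flux inequality and the evaluation of the flux side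
  have h15 := abs_integral_lipschitz_mul_inner_le (φ := fun g => φ (g * u0)) hL hψL
    (contDiff_fluxField κ (d' + ((p * (1 - κ ^ 2 / 20) : ℝ) : ℍ)) (p * (κ ^ 2 / 20)) (-(p * (Zp / Z)))) h0
  beta_reduce at h15
  have hc : ∀ t : ℝ, 4 * (-(p * (Zp / Z))) + κ * (d' + ((p * (1 - κ ^ 2 / 20) : ℝ) : ℍ)).re +
      (5 * (p * (κ ^ 2 / 20)) + κ * (-(p * (Zp / Z)))) * t + κ * (p * (κ ^ 2 / 20)) * t ^ 2 =
      p * ((κ * (1 - κ ^ 2 / 20) - 4 * (Zp / Z)) + (κ ^ 2 / 4 - κ * (Zp / Z)) * t + (κ ^ 3 / 20) * t ^ 2) := fun t => by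
    rw [Quaternion.re_add, hd're, Quaternion.re_coe]; ring
  rw [fluxRHS_eq κ (p * (κ ^ 2 / 20)) (-(p * (Zp / Z))) p (κ * (1 - κ ^ 2 / 20) - 4 * (Zp / Z))
    (κ ^ 2 / 4 - κ * (Zp / Z)) (κ ^ 3 / 20) (d' + ((p * (1 - κ ^ 2 / 20) : ℝ) : ℍ)) hc] at h15
  have hfb := flux_bound127 hκ0 hκ1 hd're hn2 (norm_nonneg (qp Δ)) hZ hZp rfl rfl rfl rfl rfl rfl rfl rfl rfl rfl rfl rfl
  -- assembly
  rw [hc1, integral_tilted]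
  simp_rw [smul_eq_mul, div_mul_eq_mul_div]
  rw [integral_div, hZrot, hnum, abs_div, abs_of_pos hZpos, div_le_iff₀ hZpos, abs_mul,
    abs_of_pos (by norm_num : (0:ℝ) < 4)]
  have hs := sqrt_two_mul_norm_qp_le Δ
  have h2L : 0 ≤ Real.sqrt 2 * L := mul_nonneg (Real.sqrt_nonneg _) hL
  calc 4 * |∫ g, φ (g * u0) * ⟪Real.exp (κ * (su2Quat g).re) • ((d' + ((p * (1 - κ ^ 2 / 20) : ℝ) : ℍ)) +
        ((p * (κ ^ 2 / 20)) * (su2Quat g).re + -(p * (Zp / Z))) • su2Quat g), su2Quat g⟫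
        ∂haarProbability (Matrix.specialUnitaryGroup (Fin 2) ℂ)|
      ≤ 4 * (Real.sqrt 2 * L * (Z / 4 * ‖qp Δ‖)) := by
        have := mul_le_mul_of_nonneg_left hfb h2L
        linarith
    _ = (Real.sqrt 2 * ‖qp Δ‖) * L * Z := by ring
    _ ≤ frobNorm Δ * L * Z := mul_le_mul_of_nonneg_right (mul_le_mul_of_nonneg_right hs hL) hZpos.le
    _ = L * frobNorm Δ * Z := by ring

end Summit.QuantumFields.BalabanUV.InfraRed.StrongCouplingTwelveSeventhsCovariance
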